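import Summits.QuantumFields.BalabanUV.T4Continuum.Support.B13OpDatumJunctions
import Summits.QuantumFields.BalabanUV.T4Continuum.Support.OutputRateTowerSocket
import Literature.MathematicalPhysics.QuantumFieldTheory.Balaban1983to89.T4Cov2156Rate

/-!
# B13Readings — row O4-r READINGS of the NE5 O1 claim table: species-wise packaging of the operator datum's two-run
# bounds, the TOWER reading of a species typed as a unit-lattice tower value (constant-weight block), and the
# HYPOTHESIS-FREE reading of the covariance species at `U = 1` from row NE2's `T4Cov2156Rate` (B6 (2.156), θ = L⁻¹)

Cell `pub-balaban`, unit `b2b-balaban-t4-ne5-formalise-leaf-07` (NE5 formalisation swarm, LEAF PROVER 07; row **O4-r READINGS**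
of `t4/b2b-balaban-t4-ne5-p1/O1-CLAIM-TABLE-NE5-P1.md`, after this seat's row O1-b `Support/B13OpDatum` p207653 ∕
`Support/B13OpDatumJunctions` p207906).  Summits-side NEW WORK under the LEAN PLACEMENT RULE (readings = identifications +
bookkeeping; print cited for KIND only).  HONEST FRAMING: rung (B)+1 of the FINITE-VOLUME T⁴ continuum programme — NOT
infinite volume, NOT a mass gap, NOT the Clay problem, NOT a proof of NE5 (the series prints ε-UNIFORM bounds, never
η-RATES).  HONEST DEPENDENCY (cell, verbatim): continuum YM on T⁴ ⇐ BetaPertH ∧ nine spine estimates (0/9 proved); BetaPertH ⇐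
(D1) ∧ (D4) ∧ CAP+tail; G-an2-4 gates asym, D1 and NE2/3/4.

WHAT A READING IS (liaison `T4OperatorRateLiaison` (L1)–(L2); socket `OutputRateTowerSocket.ReadsTower`).  Row O1-b typed the
step's operator datum as normalised weighted entries (`OpDatum (Species T κ ι Ω 𝒴)`, raw suppliers `RawSpecies`, data maps
`opOf`); W1 (`StepModel.OperatorRate`) is then fed species by species from a TWO-RUN ENTRY BOUND per species
(`B13OpDatumJunctions.WeightedEntrywiseRate` ⇒ `AbsOperatorRate` ⇒ `OperatorRate`).  A READING says WHICH tree object a species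
of an instantiation IS, so that the species' two-run entry bound is that object's landed two-run statement BY NAME.

§1 SPECIES-WISE PACKAGING.  `SpeciesFormatBy F r R` (one-run: every species of `r` in the format ball of radius `R`) ⇒
`InFormat F r.kernel R` (`inFormat_kernel`); `SpeciesEntryBound F r r′ R` (two-run: every species of `r − r′` entrywise
`≤ R·wt`) ⇒ the kernel bound (`kernel_sub_le`); hence `rawBounded_of_formatBy`, `weightedEntrywiseRate_of_entryBound` — each
species may take ITS OWN currency (tower, entrywise NE2⁺, `LocalRate`, …) and the datum-level shapes of part 2 follow.

§2 THE TOWER READING (constant-weight block).  For a species typed AS the entries of a unit-lattice tower value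
`CovariantAveragingTower.avgTow (A j) r (X j) n` at an index embedding `σ` (run A: `n = k` fine levels, run B: `n = k + 1`),
row NE2's law for the family (`OutputRateTowerSocket.TowerLaw` + `TowerContracting`, BY NAME) bounds every entry of the
increment by `Cop·θ^k` (`norm_entry_le_l2_opNorm`: an entry is at most the `ℓ²`-operator norm), i.e. by `(Cop ∕ w₀)·θ^k·w₀`
against a CONSTANT weight `w₀` (`towerEntry_rate_of_towerLaw`).  Honest: a constant-weight block forgoes route P2's decaying
calibration for that species (part 2's «which currency fits»); with a decaying weight the same increment costs `1 ∕ min wt`.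

§3 THE HYPOTHESIS-FREE READING OF THE COVARIANCE SPECIES AT `U = 1`.  Row NE2's `T4Cov2156Rate.cov2156_pair_torus` (lineage
t4-ne2-p2; Bałaban's gauge-field fluctuation covariance `C^{(k)} = C(C*Δ_kC)⁻¹C*` of [Balaban1984PropagatorsII] (2.156) p. 250
at `U = 1` on every unit torus `Z^d∕(M₁Z × ⋯ × M_dZ)`, `L ∣ M_i`, `d ≥ 2`; King's (4.38) SHAPE) gives ONE `(B₀, δ₀)` depending
on `(d, L)` only with the DECAY `|C^{(k)}(b,b′)| ≤ B₀e^{−δ₀ρ(b,b′)}` and the ONE-STEP RATE `|C^{(k+1)}(b,b′) − C^{(k)}(b,b′)| ≤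
B₀e^{−δ₀ρ(b,b′)}(L⁻¹)^k` — EXACTLY a one-run `SpeciesFormatBy`-bound and a `LevelEntryRate`-bound for the covariance species in the
DECAYING format `wt (cov t b b′) ≥ e^{−δ₀ρ(b,b′)}` (`covKerU1_pair`).  So for any instantiation whose covariance species READS
`C^{(k)}(𝟙)` — run A's `cov t b b′` at step `k` IS `covKerU1 L M k b b′`, run B's IS `covKerU1 L M (k+1) b b′` (hypothesis
shapes `ReadsCovU1A∕B`, `rfl` for a supplier so defined) — the covariance conjuncts of §1 HOLD with `c = B₀`, `rate k = (L⁻¹)^k`,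
uniformly in the torus (`cov_formatBy_U1`, `cov_entryBound_U1`): the NE5 leaf L07r∕L07 INSTANTIATED FOR THE COVARIANCE
SPECIES AT `U = 1` — and for that species only.

WALL (trigger c6; said once).  The other four species (`deltaKer`, `gammaConstituent`, `potQ`, `potR`) and the covariance AT A
BACKGROUND `U ≠ 1` have NO two-run supplier in the tree: their entry bounds are row NE2's NE2⁺ (`T4EtaRate.NE2PlusUnit` ∕
`NE2PlusOperator`, cell GAPS G-t4-U1a-1, open row G-an2-4) and stay DISPLAYED BINDERS of §1's `SpeciesEntryBound`; nothing weaker is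
filed under this leaf's name.  The insertion half of row O4-r (`InsOpModel.ReadsIns`) is GENERIC in leaf-06's
`B13HistInsertion.readsIns_of_reads` and is imported by name by whoever assembles `B13Step` (row O1-e); not redone here.
0 sorry; every `def` is data or a hypothesis SHAPE; every theorem is bookkeeping or a composition of landed theorems BY NAME.
-/

noncomputable section

open scoped BigOperators ENNReal Matrix Matrix.Norms.L2Operator

namespace Summit.QuantumFields.BalabanUV.T4Continuum.B13Readings

open Summit.QuantumFields.BalabanUV.T4Continuum.B13OpDatum
open Summit.QuantumFields.BalabanUV.T4Continuum.B13OpDatumJunctions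
open Summit.QuantumFields.BalabanUV.T4Continuum.CovariantAveragingTower (avgTow)
open Summit.QuantumFields.BalabanUV.T4Continuum.OutputRateTowerSocket (TowerContracting TowerLaw
  norm_avgTow_succ_sub_le_of_towerLaw)
open Literature.MathematicalPhysics.QuantumFieldTheory.Balaban1983to89
open Literature.MathematicalPhysics.QuantumFieldTheory.Balaban1983to89.B6Lemma24Torus (pbox)
open Literature.MathematicalPhysics.QuantumFieldTheory.Balaban1983to89.B6BondEliminationTorus (pdist)
open Literature.MathematicalPhysics.QuantumFieldTheory.Balaban1983to89.B6Cov2156Torus (deltaPol bondReductionT one_le_M)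
open Literature.MathematicalPhysics.QuantumFieldTheory.Balaban1983to89.T4Cov2156Rate (cov2156_pair_torus)

/-! ## §1 Species-wise packaging of one-run format bounds and two-run entry bounds -/

section Species

variable {T κ ι Ω 𝒴 : Type*} (F : Format (Species T κ ι Ω 𝒴))

/-- HYPOTHESIS SHAPE (one run, species by species; printed KIND: B13 (2.16) p. 16, (1.43) p. 11, (1.36) p. 9 — asserted
nowhere): every species of the raw record `r` lies in the format ball of radius `R`. [folklore] -/
@[folklore]
structure SpeciesFormatBy (r : RawSpecies T κ ι Ω 𝒴) (R : ℝ) : Prop where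
  cov : ∀ t a' a'', ‖r.cov t a' a''‖ ≤ R * F.wt (.cov t a' a'')
  deltaKer : ∀ t i j, ‖r.deltaKer t i j‖ ≤ R * F.wt (.deltaKer t i j)
  gammaConstituent : ∀ t a' i, ‖r.gammaConstituent t a' i‖ ≤ R * F.wt (.gammaConstituent t a' i)
  potQ : ∀ x Y b b', ‖r.potQ x Y b b'‖ ≤ R * F.wt (.potQ x Y b b')
  potR : ∀ x Y, ‖r.potR x Y‖ ≤ R * F.wt (.potR x Y)

/-- HYPOTHESIS SHAPE (two runs, species by species; NOT PRINTED — each conjunct is the species' own two-run currency: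
tower ∕ NE2⁺ entrywise ∕ `LocalRate`): every species of `r` and `r′` differs entrywise by at most `R·wt`. [folklore] -/
@[folklore]
structure SpeciesEntryBound (r r' : RawSpecies T κ ι Ω 𝒴) (R : ℝ) : Prop where
  cov : ∀ t a' a'', ‖r.cov t a' a'' - r'.cov t a' a''‖ ≤ R * F.wt (.cov t a' a'')
  deltaKer : ∀ t i j, ‖r.deltaKer t i j - r'.deltaKer t i j‖ ≤ R * F.wt (.deltaKer t i j)
  gammaConstituent : ∀ t a' i,
    ‖r.gammaConstituent t a' i - r'.gammaConstituent t a' i‖ ≤ R * F.wt (.gammaConstituent t a' i)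
  potQ : ∀ x Y b b', ‖r.potQ x Y b b' - r'.potQ x Y b b'‖ ≤ R * F.wt (.potQ x Y b b')
  potR : ∀ x Y, ‖r.potR x Y - r'.potR x Y‖ ≤ R * F.wt (.potR x Y)

variable {F}

/-- [folklore] Species-wise format bounds ARE a format bound of the kernel. -/
theorem SpeciesFormatBy.inFormat_kernel {r : RawSpecies T κ ι Ω 𝒴} {R : ℝ} (h : SpeciesFormatBy F r R) :
    InFormat F r.kernel R := fun e => by
  cases e with
  | cov t a' a'' => exact h.cov t a' a''
  | deltaKer t i j => exact h.deltaKer t i j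
  | gammaConstituent t a' i => exact h.gammaConstituent t a' i
  | potQ x Y b b' => exact h.potQ x Y b b'
  | potR x Y => exact h.potR x Y

/-- [folklore] Species-wise two-run entry bounds ARE an entry bound of the kernels. -/
theorem SpeciesEntryBound.kernel_sub_le {r r' : RawSpecies T κ ι Ω 𝒴} {R : ℝ} (h : SpeciesEntryBound F r r' R) :
    ∀ e, ‖r.kernel e - r'.kernel e‖ ≤ R * F.wt e := fun e => by
  cases e with
  | cov t a' a'' => exact h.cov t a' a''
  | deltaKer t i j => exact h.deltaKer t i j
  | gammaConstituent t a' i => exact h.gammaConstituent t a' i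
  | potQ x Y b b' => exact h.potQ x Y b b'
  | potR x Y => exact h.potR x Y

variable {Bg : Type*}

/-- [folklore] `RawBounded` of the kernel suppliers from species-wise one-run format bounds on the window. -/
theorem rawBounded_of_formatBy {Fk : ℕ → Format (Species T κ ι Ω 𝒴)} {raw : (ℕ → ℝ) → Bg → ℕ → RawSpecies T κ ι Ω 𝒴}
    {W : Set (ℕ → ℝ)} {R : ℕ → ℝ} (h : ∀ k, ∀ g ∈ W, ∀ U : Bg, SpeciesFormatBy (Fk k) (raw g U k) (R k)) :
    RawBounded Fk (fun g U k => (raw g U k).kernel) W :=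
  fun k g hg U => (h k g hg U).inFormat_kernel.formatBounded

/-- [folklore] **`WeightedEntrywiseRate` of the kernel suppliers from species-wise two-run entry bounds `c·rate k` on the
window** — the datum-level shape of part 2, hence `AbsOperatorRate` ∕ `OperatorRate` by `absRate_of_weightedEntrywise` ∕
`operatorRate_of_weightedEntrywise_floor`. -/
theorem weightedEntrywiseRate_of_entryBound {Fk : ℕ → Format (Species T κ ι Ω 𝒴)}
    {rawA rawB : (ℕ → ℝ) → Bg → ℕ → RawSpecies T κ ι Ω 𝒴} {W : Set (ℕ → ℝ)} {c : ℝ} {rate : ℕ → ℝ}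
    (h : ∀ k, ∀ g ∈ W, ∀ U : Bg, SpeciesEntryBound (Fk k) (rawA g U k) (rawB g U k) (c * rate k)) :
    WeightedEntrywiseRate Fk (fun g U k => (rawA g U k).kernel) (fun g U k => (rawB g U k).kernel) W c rate :=
  fun k g hg U e => (h k g hg U).kernel_sub_le e

end Species

/-! ## §2 The tower reading: a species typed AS the entries of a unit-lattice tower value (constant-weight block) -/

section Tower

/-- [folklore] An entry of a complex matrix is at most its `ℓ²`-operator norm (test against the basis vector `e_j`;
the `Fin N` case is `Literature.Barriers.…UnitaryHaarSmallBall.norm_entry_le_l2_opNorm`). -/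
theorem norm_entry_le_l2_opNorm {m n : Type*} [Fintype m] [Fintype n] [DecidableEq n] (A : Matrix m n ℂ) (i : m)
    (j : n) : ‖A i j‖ ≤ ‖A‖ := by
  set v : EuclideanSpace ℂ n := PiLp.single 2 j (1 : ℂ) with hv
  have hv1 : ‖v‖ = 1 := by rw [hv, PiLp.norm_single, norm_one]
  have h1 := Matrix.l2_opNorm_mulVec A v
  rw [hv1, mul_one] at h1
  have h2 : ‖((EuclideanSpace.equiv m ℂ).symm (Matrix.mulVec A v.ofLp)) i‖ ≤
      ‖(EuclideanSpace.equiv m ℂ).symm (Matrix.mulVec A v.ofLp)‖ := PiLp.norm_apply_le _ i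
  have h3 : ((EuclideanSpace.equiv m ℂ).symm (Matrix.mulVec A v.ofLp)) i = A i j := by
    have : v.ofLp = Pi.single j 1 := by
      rw [hv]; rfl
    simp [this]
  rw [h3] at h2
  exact h2.trans h1

variable {J : Type*} {ιt : J → ℕ → Type*} [∀ j k, Fintype (ιt j k)] [∀ j k, DecidableEq (ιt j k)]

/-- [folklore] **THE TOWER READING, ENTRY BY ENTRY**: under row NE2's law for the family (`TowerLaw`, `TowerContracting` BY
NAME, constants `Cop`, `θ`, `r`), the entries of consecutive unit-lattice images of tower `j` read at an index embedding `σ`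
differ by at most `(Cop ∕ w₀)·θ^k·w₀` — the `SpeciesEntryBound` conjunct of a species typed AS these entries with the CONSTANT
weight `w₀` on its block (run A: `k` levels, run B: `k + 1`). -/
theorem towerEntry_rate_of_towerLaw {A : (j : J) → (k : ℕ) → Matrix (ιt j k) (ιt j (k + 1)) ℂ}
    {X : (j : J) → (k : ℕ) → Matrix (ιt j k) (ιt j k) ℂ} {r Cop θ w₀ : ℝ} (hr : 0 < r) (hA : TowerContracting A r)
    (hlaw : TowerLaw A X r Cop θ) (hw₀ : 0 < w₀) {κ : Type*} (j : J) (σ : κ → ιt j 0) (k : ℕ) (a' a'' : κ) :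
    ‖avgTow (A j) r (X j) k (σ a') (σ a'') - avgTow (A j) r (X j) (k + 1) (σ a') (σ a'')‖ ≤ Cop / w₀ * θ ^ k * w₀ := by
  rw [div_mul_eq_mul_div, div_mul_cancel₀ _ hw₀.ne', norm_sub_rev]
  calc ‖avgTow (A j) r (X j) (k + 1) (σ a') (σ a'') - avgTow (A j) r (X j) k (σ a') (σ a'')‖
      = ‖(avgTow (A j) r (X j) (k + 1) - avgTow (A j) r (X j) k) (σ a') (σ a'')‖ := by
        rw [Matrix.sub_apply]
    _ ≤ ‖avgTow (A j) r (X j) (k + 1) - avgTow (A j) r (X j) k‖ := norm_entry_le_l2_opNorm _ _ _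
    _ ≤ Cop * θ ^ k := norm_avgTow_succ_sub_le_of_towerLaw hr hA hlaw j k

end Tower

/-! ## §3 The hypothesis-free reading of the covariance species at `U = 1` (row NE2's `T4Cov2156Rate` BY NAME) -/

section CovU1

variable {d : ℕ}

/-- THE `U = 1` COVARIANCE KERNEL WITH `k` FINE LEVELS, as complex entries: `C^{(k)}(b, b′)` for `C^{(k)} = C(C*Δ^{(L^k)}C)⁻¹C*`
of [Balaban1984PropagatorsII] (2.156) p. 250 on the unit torus `Z^d∕(M₁Z × ⋯ × M_dZ)` with the full elimination matrix (row
NE2's `bondReductionT L M (deltaPol M (L ^ k))`, lineages t4-ne2-p2 ∕ pv09 ∕ b05 — imported BY NAME). [folklore] -/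
def covKerU1 (L : ℕ) (M : Fin d → ℕ) [∀ μ, NeZero (M μ)] (k : ℕ) (p q : B4.Idx (pbox M) d) : ℂ :=
  (((bondReductionT L M (deltaPol M (L ^ k))).cov p q : ℝ) : ℂ)

/-- [folklore] **THE (DECAY, ONE-STEP RATE) PAIR FOR THE COVARIANCE SPECIES AT `U = 1`, IN ENTRY-FORMAT CURRENCY** (row NE2's
`cov2156_pair_torus` BY NAME, recast for complex entries and the run-A-minus-run-B order): ONE `(B₀, δ₀)` depending on `(d, L)`
only such that on every unit torus with `L ∣ M_i`, for all `k, b, b′`: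
`‖covKerU1 L M k b b′‖ ≤ B₀·e^{−δ₀ρ(b,b′)}` and `‖covKerU1 L M k b b′ − covKerU1 L M (k+1) b b′‖ ≤ B₀·(L⁻¹)^k·e^{−δ₀ρ(b,b′)}`. -/
theorem covKerU1_pair (hd : 2 ≤ d) {L : ℕ} (hL : 1 ≤ L) :
    ∃ B₀ δ₀ : ℝ, 0 < B₀ ∧ 0 < δ₀ ∧
      ∀ (M : Fin d → ℕ) [∀ μ, NeZero (M μ)], (∀ i, L ∣ M i) → ∀ (k : ℕ) (p q : B4.Idx (pbox M) d),
        ‖covKerU1 L M k p q‖ ≤ B₀ * Real.exp (-(δ₀ * pdist M (one_le_M M) (p.1 : Fin d → ℤ) (q.1 : Fin d → ℤ))) ∧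
        ‖covKerU1 L M k p q - covKerU1 L M (k + 1) p q‖ ≤
          B₀ * ((L : ℝ)⁻¹) ^ k * Real.exp (-(δ₀ * pdist M (one_le_M M) (p.1 : Fin d → ℤ) (q.1 : Fin d → ℤ))) := by
  obtain ⟨B₀, δ₀, hB₀, hδ₀, H⟩ := cov2156_pair_torus d hd hL
  refine ⟨B₀, δ₀, hB₀, hδ₀, fun M _ hLM k p q => ?_⟩
  obtain ⟨h1, h2⟩ := H M hLM k p q
  refine ⟨?_, ?_⟩
  · rw [covKerU1, Complex.norm_real, Real.norm_eq_abs]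
    exact h1
  · rw [covKerU1, covKerU1, ← Complex.ofReal_sub, Complex.norm_real, Real.norm_eq_abs, abs_sub_comm]
    calc _ ≤ B₀ * Real.exp (-(δ₀ * pdist M (one_le_M M) (p.1 : Fin d → ℤ) (q.1 : Fin d → ℤ))) * ((L : ℝ)⁻¹) ^ k := h2
      _ = _ := by ring

variable {T ι Ω 𝒴 Bg : Type*} {L : ℕ} {M : Fin d → ℕ} [∀ μ, NeZero (M μ)]

/-- HYPOTHESIS SHAPE **`ReadsCovU1A`** (the READING of run A's covariance species — an identification, no inequality): at
every step `k`, every slot, run A's raw covariance entries ARE the `U = 1` covariance with `k` fine levels. `rfl` for a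
supplier so defined. [folklore] -/
@[folklore]
def ReadsCovU1A (L : ℕ) (M : Fin d → ℕ) [∀ μ, NeZero (M μ)]
    (rawA : (ℕ → ℝ) → Bg → ℕ → RawSpecies T (B4.Idx (pbox M) d) ι Ω 𝒴) (W : Set (ℕ → ℝ)) : Prop :=
  ∀ k, ∀ g ∈ W, ∀ (U : Bg) (t : T) (p q : B4.Idx (pbox M) d), (rawA g U k).cov t p q = covKerU1 L M k p q

/-- HYPOTHESIS SHAPE **`ReadsCovU1B`**: run B's raw covariance entries at the paired step ARE the `U = 1` covariance with
`k + 1` fine levels. [folklore] -/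
@[folklore]
def ReadsCovU1B (L : ℕ) (M : Fin d → ℕ) [∀ μ, NeZero (M μ)]
    (rawB : (ℕ → ℝ) → Bg → ℕ → RawSpecies T (B4.Idx (pbox M) d) ι Ω 𝒴) (W : Set (ℕ → ℝ)) : Prop :=
  ∀ k, ∀ g ∈ W, ∀ (U : Bg) (t : T) (p q : B4.Idx (pbox M) d), (rawB g U k).cov t p q = covKerU1 L M (k + 1) p q

/-- HYPOTHESIS SHAPE (the covariance block of the step-`k` format DOMINATES the decaying weight `e^{−δ₀ρ}` of the instance —
e.g. `B13Weights.format` with `d ↦ ρ`, `q ↦ id` and decay rate `≤ δ₀`). [folklore] -/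
@[folklore]
def CovWeightDominates (M : Fin d → ℕ) [∀ μ, NeZero (M μ)] (Fk : ℕ → Format (Species T (B4.Idx (pbox M) d) ι Ω 𝒴))
    (δ₀ : ℝ) : Prop :=
  ∀ (k : ℕ) (t : T) (p q : B4.Idx (pbox M) d),
    Real.exp (-(δ₀ * pdist M (one_le_M M) (p.1 : Fin d → ℤ) (q.1 : Fin d → ℤ))) ≤ (Fk k).wt (.cov t p q)

/-- [folklore] **NE5 LEAF L07r∕L07 INSTANTIATED FOR THE COVARIANCE SPECIES AT `U = 1` — ONE RUN**: under the reading, run A's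
covariance species satisfies the `SpeciesFormatBy` conjunct with the instance's `B₀`, on every step and uniformly in the torus. -/
theorem cov_formatBy_U1 {Fk : ℕ → Format (Species T (B4.Idx (pbox M) d) ι Ω 𝒴)}
    {rawA : (ℕ → ℝ) → Bg → ℕ → RawSpecies T (B4.Idx (pbox M) d) ι Ω 𝒴} {W : Set (ℕ → ℝ)} {B₀ δ₀ : ℝ} (hB₀ : 0 ≤ B₀)
    (hpair : ∀ (k : ℕ) (p q : B4.Idx (pbox M) d),
      ‖covKerU1 L M k p q‖ ≤ B₀ * Real.exp (-(δ₀ * pdist M (one_le_M M) (p.1 : Fin d → ℤ) (q.1 : Fin d → ℤ))))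
    (hread : ReadsCovU1A L M rawA W) (hdom : CovWeightDominates M Fk δ₀) (k : ℕ) {g : ℕ → ℝ} (hg : g ∈ W) (U : Bg)
    (t : T) (p q : B4.Idx (pbox M) d) : ‖(rawA g U k).cov t p q‖ ≤ B₀ * (Fk k).wt (.cov t p q) := by
  rw [hread k g hg U t p q]
  exact (hpair k p q).trans (mul_le_mul_of_nonneg_left (hdom k t p q) hB₀)

/-- [folklore] **NE5 LEAF L07r∕L07 INSTANTIATED FOR THE COVARIANCE SPECIES AT `U = 1` — TWO RUNS**: under the readings, the
covariance conjunct of `SpeciesEntryBound` holds with `c = B₀` and `rate k = (L⁻¹)^k`, on every step, uniformly in the torus — the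
two-run η-rate input of W1 for this species is row NE2's THEOREM, not a binder. -/
theorem cov_entryBound_U1 {Fk : ℕ → Format (Species T (B4.Idx (pbox M) d) ι Ω 𝒴)}
    {rawA rawB : (ℕ → ℝ) → Bg → ℕ → RawSpecies T (B4.Idx (pbox M) d) ι Ω 𝒴} {W : Set (ℕ → ℝ)} {B₀ δ₀ : ℝ}
    (hB₀ : 0 ≤ B₀)
    (hpair : ∀ (k : ℕ) (p q : B4.Idx (pbox M) d), ‖covKerU1 L M k p q - covKerU1 L M (k + 1) p q‖ ≤
      B₀ * ((L : ℝ)⁻¹) ^ k * Real.exp (-(δ₀ * pdist M (one_le_M M) (p.1 : Fin d → ℤ) (q.1 : Fin d → ℤ))))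
    (hreadA : ReadsCovU1A L M rawA W) (hreadB : ReadsCovU1B L M rawB W) (hdom : CovWeightDominates M Fk δ₀) (k : ℕ)
    {g : ℕ → ℝ} (hg : g ∈ W) (U : Bg) (t : T) (p q : B4.Idx (pbox M) d) :
    ‖(rawA g U k).cov t p q - (rawB g U k).cov t p q‖ ≤ B₀ * ((L : ℝ)⁻¹) ^ k * (Fk k).wt (.cov t p q) := by
  rw [hreadA k g hg U t p q, hreadB k g hg U t p q]
  have hLk : 0 ≤ B₀ * ((L : ℝ)⁻¹) ^ k :=
    mul_nonneg hB₀ (pow_nonneg (inv_nonneg.mpr (by exact_mod_cast (Nat.zero_le L))) k)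
  exact (hpair k p q).trans (mul_le_mul_of_nonneg_left (hdom k t p q) hLk)

/-- [folklore] **THE COVARIANCE SPECIES' W1 INPUT IS A THEOREM AT `U = 1`** (assembly of `covKerU1_pair` with the two
readings): there are `B₀ > 0`, `δ₀ > 0` depending on `(d, L)` only such that for EVERY unit torus with `L ∣ M_i`, every
format dominating `e^{−δ₀ρ}` on the covariance block and every pair of suppliers reading `C^{(k)}(𝟙)` ∕ `C^{(k+1)}(𝟙)`, the
covariance conjuncts of `SpeciesFormatBy` (radius `B₀`) and `SpeciesEntryBound` (`B₀·(L⁻¹)^k`) hold at every step of the window. -/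
theorem cov_reading_U1 (hd : 2 ≤ d) {L : ℕ} (hL : 1 ≤ L) :
    ∃ B₀ δ₀ : ℝ, 0 < B₀ ∧ 0 < δ₀ ∧ ∀ (M : Fin d → ℕ) [∀ μ, NeZero (M μ)], (∀ i, L ∣ M i) →
      ∀ (Fk : ℕ → Format (Species T (B4.Idx (pbox M) d) ι Ω 𝒴))
        (rawA rawB : (ℕ → ℝ) → Bg → ℕ → RawSpecies T (B4.Idx (pbox M) d) ι Ω 𝒴) (W : Set (ℕ → ℝ)),
        ReadsCovU1A L M rawA W → ReadsCovU1B L M rawB W → CovWeightDominates M Fk δ₀ →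
          ∀ k, ∀ g ∈ W, ∀ (U : Bg) (t : T) (p q : B4.Idx (pbox M) d),
            ‖(rawA g U k).cov t p q‖ ≤ B₀ * (Fk k).wt (.cov t p q) ∧
            ‖(rawA g U k).cov t p q - (rawB g U k).cov t p q‖ ≤ B₀ * ((L : ℝ)⁻¹) ^ k * (Fk k).wt (.cov t p q) := by
  obtain ⟨B₀, δ₀, hB₀, hδ₀, H⟩ := covKerU1_pair (d := d) hd hL
  refine ⟨B₀, δ₀, hB₀, hδ₀, fun M _ hLM Fk rawA rawB W hA hB hdom k g hg U t p q => ⟨?_, ?_⟩⟩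
  · exact cov_formatBy_U1 hB₀.le (fun k p q => (H M hLM k p q).1) hA hdom k hg U t p q
  · exact cov_entryBound_U1 hB₀.le (fun k p q => (H M hLM k p q).2) hA hB hdom k hg U t p q

end CovU1


/-! ## §4 (v1.1) The localised covariance species: slot `t` ↦ a sub-family `S ⊆ freeT` (the `Z₀`-localisation
`C_S^{(k)} = C_S(C_S*Δ_kC_S)⁻¹C_S*` of (2.156)), hypothesis-free at `U = 1` from row NE2's sub-family theorems -/

section CovU1Local

open Literature.MathematicalPhysics.QuantumFieldTheory.King1986 (exp_decay_mono)
open Literature.MathematicalPhysics.QuantumFieldTheory.Balaban1983to89.B6Cov2156Torus (freeT)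
open Literature.MathematicalPhysics.QuantumFieldTheory.Balaban1983to89.B6Cov2156TorusSubset (subFamilyT)
open Literature.MathematicalPhysics.QuantumFieldTheory.Balaban1983to89.B6Cov2156Subset166 (cov2156_torusS_166)
open Literature.MathematicalPhysics.QuantumFieldTheory.Balaban1983to89.T4Cov2156Rate (cov2156_rate_subfamily_king
  bondDist_nonneg)

variable {d : ℕ}

/-- THE LOCALISED `U = 1` COVARIANCE KERNEL WITH `k` FINE LEVELS on the sub-family `S` of kept bond variables (every
`Λ = B(Λ′₀) ⊂ T` is such an `S`, row NE2's `bondReductionLam`): the entries of `C_S(C_S*Δ^{(L^k)}C_S)⁻¹C_S*` of (2.156) p. 250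
(row NE2's `subFamilyT L M S hS (deltaPol M (L ^ k))`, imported BY NAME), as complex numbers. [folklore] -/
def covKerU1S (L : ℕ) (M : Fin d → ℕ) [∀ μ, NeZero (M μ)] (S : Finset (B4.Idx (pbox M) d)) (hS : S ⊆ freeT L M)
    (k : ℕ) (p q : B4.Idx (pbox M) d) : ℂ :=
  (((subFamilyT L M S hS (deltaPol M (L ^ k))).cov p q : ℝ) : ℂ)

/-- [folklore] **THE (DECAY, ONE-STEP RATE) PAIR FOR EVERY LOCALISED COVARIANCE AT `U = 1`** (row NE2's `cov2156_torusS_166`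
and `cov2156_rate_subfamily_king` BY NAME, combined to ONE `(B₀, δ₀)` depending on `(d, L)` only — uniformly in the torus
AND in the sub-family `S`): `‖C_S^{(k)}(p,q)‖ ≤ B₀e^{−δ₀ρ(p,q)}` and `‖C_S^{(k)}(p,q) − C_S^{(k+1)}(p,q)‖ ≤ B₀(L⁻¹)^k e^{−δ₀ρ(p,q)}`. -/
theorem covKerU1S_pair (hd : 2 ≤ d) {L : ℕ} (hL : 1 ≤ L) :
    ∃ B₀ δ₀ : ℝ, 0 < B₀ ∧ 0 < δ₀ ∧
      ∀ (M : Fin d → ℕ) [∀ μ, NeZero (M μ)], (∀ i, L ∣ M i) →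
        ∀ (S : Finset (B4.Idx (pbox M) d)) (hS : S ⊆ freeT L M) (k : ℕ) (p q : B4.Idx (pbox M) d),
        ‖covKerU1S L M S hS k p q‖ ≤ B₀ * Real.exp (-(δ₀ * pdist M (one_le_M M) (p.1 : Fin d → ℤ) (q.1 : Fin d → ℤ))) ∧
        ‖covKerU1S L M S hS k p q - covKerU1S L M S hS (k + 1) p q‖ ≤
          B₀ * ((L : ℝ)⁻¹) ^ k * Real.exp (-(δ₀ * pdist M (one_le_M M) (p.1 : Fin d → ℤ) (q.1 : Fin d → ℤ))) := by
  obtain ⟨c, δ, hc, hδ, hD⟩ := cov2156_torusS_166 d hd hL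
  obtain ⟨C', δ', hC', hδ', H⟩ := cov2156_rate_subfamily_king d hd hL
  refine ⟨max c C', min δ δ', lt_max_of_lt_left hc, lt_min hδ hδ', fun M _ hLM S hS k p q => ⟨?_, ?_⟩⟩
  · have h0 := hD M hLM (L ^ k) (Nat.one_le_pow _ _ hL) S hS p q
    have hdd := bondDist_nonneg (one_le_M M) p q
    rw [covKerU1S, Complex.norm_real, Real.norm_eq_abs]
    calc _ ≤ c * Real.exp (-(δ * pdist M (one_le_M M) (p.1 : Fin d → ℤ) (q.1 : Fin d → ℤ))) := h0
      _ ≤ c * Real.exp (-(min δ δ' * pdist M (one_le_M M) (p.1 : Fin d → ℤ) (q.1 : Fin d → ℤ))) :=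
          exp_decay_mono hc.le (min_le_left _ _) hdd
      _ ≤ max c C' * Real.exp (-(min δ δ' * pdist M (one_le_M M) (p.1 : Fin d → ℤ) (q.1 : Fin d → ℤ))) :=
          mul_le_mul_of_nonneg_right (le_max_left _ _) (Real.exp_nonneg _)
  · have h0 := H M hLM k 1 S hS p q
    have hdd := bondDist_nonneg (one_le_M M) p q
    have hLpos : (0 : ℝ) < L := by exact_mod_cast hL
    have e1 : ((L : ℝ) ^ k)⁻¹ = ((L : ℝ)⁻¹) ^ k := by rw [inv_pow]
    rw [covKerU1S, covKerU1S, ← Complex.ofReal_sub, Complex.norm_real, Real.norm_eq_abs, abs_sub_comm]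
    calc _ ≤ C' * ((L : ℝ) ^ k)⁻¹ * Real.exp (-(δ' * pdist M (one_le_M M) (p.1 : Fin d → ℤ) (q.1 : Fin d → ℤ))) := h0
      _ = ((L : ℝ)⁻¹) ^ k * (C' * Real.exp (-(δ' * pdist M (one_le_M M) (p.1 : Fin d → ℤ) (q.1 : Fin d → ℤ)))) := by
          rw [e1]; ring
      _ ≤ ((L : ℝ)⁻¹) ^ k * (C' * Real.exp (-(min δ δ' * pdist M (one_le_M M) (p.1 : Fin d → ℤ) (q.1 : Fin d → ℤ)))) :=
          mul_le_mul_of_nonneg_left (exp_decay_mono hC'.le (min_le_right δ δ') hdd)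
            (pow_nonneg (inv_nonneg.mpr hLpos.le) _)
      _ ≤ ((L : ℝ)⁻¹) ^ k * (max c C' * Real.exp (-(min δ δ' * pdist M (one_le_M M) (p.1 : Fin d → ℤ) (q.1 : Fin d → ℤ)))) :=
          mul_le_mul_of_nonneg_left (mul_le_mul_of_nonneg_right (le_max_right c C') (Real.exp_nonneg _))
            (pow_nonneg (inv_nonneg.mpr hLpos.le) _)
      _ = _ := by ring

variable {T ι Ω 𝒴 Bg : Type*} {L : ℕ} {M : Fin d → ℕ} [∀ μ, NeZero (M μ)]

/-- HYPOTHESIS SHAPE **`ReadsCovU1SA slot`** (the READING of run A's LOCALISED covariance species — an identification): slot `t`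
is the sub-family `slot t` (with its inclusion proof), and run A's covariance entries at slot `t`, step `k`, ARE the entries of
`C_{slot t}^{(k)}(𝟙)` with `k` fine levels. [folklore] -/
@[folklore]
def ReadsCovU1SA (L : ℕ) (M : Fin d → ℕ) [∀ μ, NeZero (M μ)] (slot : T → {S : Finset (B4.Idx (pbox M) d) // S ⊆ freeT L M})
    (rawA : (ℕ → ℝ) → Bg → ℕ → RawSpecies T (B4.Idx (pbox M) d) ι Ω 𝒴) (W : Set (ℕ → ℝ)) : Prop :=
  ∀ k, ∀ g ∈ W, ∀ (U : Bg) (t : T) (p q : B4.Idx (pbox M) d),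
    (rawA g U k).cov t p q = covKerU1S L M (slot t).1 (slot t).2 k p q

/-- HYPOTHESIS SHAPE **`ReadsCovU1SB slot`**: run B's localised covariance entries at the paired step ARE those of
`C_{slot t}^{(k+1)}(𝟙)`. [folklore] -/
@[folklore]
def ReadsCovU1SB (L : ℕ) (M : Fin d → ℕ) [∀ μ, NeZero (M μ)] (slot : T → {S : Finset (B4.Idx (pbox M) d) // S ⊆ freeT L M})
    (rawB : (ℕ → ℝ) → Bg → ℕ → RawSpecies T (B4.Idx (pbox M) d) ι Ω 𝒴) (W : Set (ℕ → ℝ)) : Prop :=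
  ∀ k, ∀ g ∈ W, ∀ (U : Bg) (t : T) (p q : B4.Idx (pbox M) d),
    (rawB g U k).cov t p q = covKerU1S L M (slot t).1 (slot t).2 (k + 1) p q

/-- [folklore] **NE5 LEAF L07r∕L07 INSTANTIATED FOR THE LOCALISED COVARIANCE SPECIES AT `U = 1`** (assembly of `covKerU1S_pair`
with the two localised readings): there are `B₀ > 0`, `δ₀ > 0` depending on `(d, L)` only such that for EVERY unit torus with
`L ∣ M_i`, every slot-to-sub-family assignment, every format dominating `e^{−δ₀ρ}` on the covariance block and every pair of
suppliers reading `C_{slot t}^{(k)}(𝟙)` ∕ `C_{slot t}^{(k+1)}(𝟙)`, the covariance conjuncts of `SpeciesFormatBy` (radius `B₀`)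
and `SpeciesEntryBound` (`B₀·(L⁻¹)^k`) hold at every step of the window — uniformly in the torus AND the localisation. -/
theorem cov_reading_U1_local (hd : 2 ≤ d) {L : ℕ} (hL : 1 ≤ L) :
    ∃ B₀ δ₀ : ℝ, 0 < B₀ ∧ 0 < δ₀ ∧ ∀ (M : Fin d → ℕ) [∀ μ, NeZero (M μ)], (∀ i, L ∣ M i) →
      ∀ (slot : T → {S : Finset (B4.Idx (pbox M) d) // S ⊆ freeT L M})
        (Fk : ℕ → Format (Species T (B4.Idx (pbox M) d) ι Ω 𝒴))
        (rawA rawB : (ℕ → ℝ) → Bg → ℕ → RawSpecies T (B4.Idx (pbox M) d) ι Ω 𝒴) (W : Set (ℕ → ℝ)),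
        ReadsCovU1SA L M slot rawA W → ReadsCovU1SB L M slot rawB W → CovWeightDominates M Fk δ₀ →
          ∀ k, ∀ g ∈ W, ∀ (U : Bg) (t : T) (p q : B4.Idx (pbox M) d),
            ‖(rawA g U k).cov t p q‖ ≤ B₀ * (Fk k).wt (.cov t p q) ∧
            ‖(rawA g U k).cov t p q - (rawB g U k).cov t p q‖ ≤ B₀ * ((L : ℝ)⁻¹) ^ k * (Fk k).wt (.cov t p q) := by
  obtain ⟨B₀, δ₀, hB₀, hδ₀, H⟩ := covKerU1S_pair (d := d) hd hL
  refine ⟨B₀, δ₀, hB₀, hδ₀, fun M _ hLM slot Fk rawA rawB W hA hB hdom k g hg U t p q => ⟨?_, ?_⟩⟩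
  · rw [hA k g hg U t p q]
    exact (H M hLM _ (slot t).2 k p q).1.trans (mul_le_mul_of_nonneg_left (hdom k t p q) hB₀.le)
  · rw [hA k g hg U t p q, hB k g hg U t p q]
    have hLk : 0 ≤ B₀ * ((L : ℝ)⁻¹) ^ k :=
      mul_nonneg hB₀.le (pow_nonneg (inv_nonneg.mpr (by exact_mod_cast (Nat.zero_le L))) k)
    exact (H M hLM _ (slot t).2 k p q).2.trans (mul_le_mul_of_nonneg_left (hdom k t p q) hLk)

end CovU1Local

end Summit.QuantumFields.BalabanUV.T4Continuum.B13Readings
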